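import Literature.NumberTheory.GaloisCohomology.Howard2004.InertTransverseDecompositionProofs
import Literature.NumberTheory.GaloisCohomology.Howard2004.InertTransverseCountProofs
import HarnessLib

/-!
# Howard 2004, Prop. 1.1.9 — the counts at an inert prime with the classical inputs discharged:
# `#H¹_tr(K_λ, T) = #T`, `#H¹(K_λ, T) = (#T)²`, `#H¹_tr · #H¹_tr = #H¹(K_λ, T)` from `(ℓ + 1)·T = 0`; and `hcyc` (proofs file)

Topic `NumberTheory/GaloisCohomology/Howard2004` (sequel to `InertTransverseCountProofs` — the counts modulo
`hGexp` / `#G_ℓ·T = 0` — and `InertTransverseDecompositionProofs`, which discharges those inputs for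
`d_K < −4`).  THEOREMS ONLY: no definition, no named fact, no instance, no `sorry`.

B. Howard, *The Heegner point Kolyvagin system*, Compositio Math. 140 (2004), Prop. 1.1.9 (arXiv:1202.6340
p. 6 L17–25): at a degree-two prime, `H¹(K_λ, T) = H¹_f ⊕ H¹_tr`, both «free of rank two» when `T ≅ R²`;
numerically `#H¹_tr(K_λ, T) = #T` and `#H¹(K_λ, T) = (#T)²`, so `#H¹_tr · #H¹_tr = #H¹(K_λ, T)` — the COUNT
input (`hcard`) of the isotropy-count criterion for the self-orthogonality (H.4) of Howard's structure
`F(n)` at `λ ∣ n` (Lemma 1.5.6, p. 10 L86–88: «the local condition `F^m(n)` is maximal isotropic away from `m`»).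
Hypotheses: `K` imaginary quadratic with `d_K < −4`, `(ℓ)` inert, `λ ∋ ℓ`, `T` finite `p`-primary with
trivial `Γ_{K_λ}`-action and `(ℓ + 1)·T = 0`.

* `natCard_galoisCohomology_toLocal_one_eq_sq_of_succ_smul` (`#H¹(K_λ, T) = (#T)²`),
  **`natCard_transverseCondition_eq_of_discr_lt`** (`#H¹_tr(K_λ, T) = #T`),
  **`natCard_transverseCondition_mul_eq_of_discr_lt`** (`#H¹_tr(K_λ, T) · #H¹_tr(K_λ', T) = #H¹(K_λ, T)`; primed:
  the `ρ.toLocal (Sum.inr v)` currency of `isSelfOrthogonalAt_of_transverse`'s `hcard`),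
  **`exists_forall_pow_inv_mul_mem_localRingClassSubgroup_of_discr_lt`** (its `hcyc`, discharged: some
  `σ₀ ∈ I_{K_λ}` with `Γ_{K_λ} = ⋃_j σ₀^j (Γ_{K_λ} ∩ Γ_{K[ℓ]})`).
Cell `pub/bsd-print-x9`, G87 (print leaf `stub_h161` of stmt-BirchSwinnertonDyer-22642); seat `bsd-line-x9-p1-w3`
g14, brick (COUNT-OF-DISCR).  BSD is not proved by any of this.

References: [Howard2004HeegnerKolyvagin] Prop. 1.1.7, Prop. 1.1.9, Lemma 1.5.6; [GrossLMS1991] §3.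
-/

set_option autoImplicit false

noncomputable section

open NumberField IsDedekindDomain IsDedekindDomain.HeightOneSpectrum Field

namespace Literature.NumberTheory.GaloisCohomology.Howard2004

open Literature.NumberTheory.GaloisRepresentations
open Literature.NumberTheory.GaloisRepresentations.DiscreteGaloisModule
open Literature.NumberTheory.GaloisRepresentations.IsNonarchimedeanLocalField
open Literature.NumberTheory.EllipticCurves

variable {K : Type} [Field K] [NumberField K] {M : Type} [AddCommGroup M] [TopologicalSpace M]
  [DiscreteTopology M]

/-- **`#H¹(K_λ, T) = (#T)²`** at an inert `λ ∋ ℓ` of a quadratic field, for a finite `T` with trivial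
`Γ_{K_λ}`-action and `(ℓ + 1)·T = 0` (`q_λ − 1 = (ℓ − 1)(ℓ + 1)` kills `T`).
[cite: Howard2004HeegnerKolyvagin, Prop. 1.1.7 / 1.1.9 (arXiv:1202.6340 p. 5 L129–141, p. 6 L17–25)] -/
theorem natCard_galoisCohomology_toLocal_one_eq_sq_of_succ_smul [Finite M] (hK2 : Module.finrank ℚ K = 2)
    (ρ : DiscreteGaloisModule K M) {ℓ : ℕ} (hℓ : ℓ.Prime) (hℓP : (Ideal.span {(ℓ : 𝓞 K)}).IsPrime)
    {v : HeightOneSpectrum (𝓞 K)} (hv : (ℓ : 𝓞 K) ∈ v.asIdeal)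
    (htriv : ∀ (g : absoluteGaloisGroup (v.adicCompletion K)) (x : M), GaloisRep.toLocal v ρ g x = x)
    (hℓT : ∀ x : M, (ℓ + 1) • x = 0) :
    Nat.card (galoisCohomology (GaloisRep.toLocal v ρ) 1) = Nat.card M ^ 2 :=
  natCard_galoisCohomology_toLocal_one_eq_sq ρ v htriv
    (residueFieldCard_sub_one_smul_eq_zero_of_succ_smul hK2 hℓ hℓP hv hℓT)

/-- **`#H¹_tr(K_λ, T) = #T`** at an inert prime (Prop. 1.1.9 numerically, classical inputs discharged): `K`
imaginary quadratic with `d_K < −4`, `(ℓ)` inert, `λ ∋ ℓ`, `T` finite `p`-primary with trivial `Γ_{K_λ}`-action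
and `(ℓ + 1)·T = 0`. [cite: Howard2004HeegnerKolyvagin, Prop. 1.1.9 (arXiv:1202.6340 p. 6 L17–25)]
[cite: GrossLMS1991, §3 (PDF p. 217 l. 1–3)] -/
theorem natCard_transverseCondition_eq_of_discr_lt [Finite M] (p : ℕ) [Fact p.Prime]
    (hK : IsImaginaryQuadratic K) (hd : NumberField.discr K < -4) (ρ : DiscreteGaloisModule K M)
    (jbar : AlgebraicClosure K →+* ℂ) {ℓ : ℕ} (hℓ : ℓ.Prime) (hℓP : (Ideal.span {(ℓ : 𝓞 K)}).IsPrime)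
    {v : HeightOneSpectrum (𝓞 K)} (hv : (ℓ : 𝓞 K) ∈ v.asIdeal)
    (htriv : ∀ (g : absoluteGaloisGroup (v.adicCompletion K)) (x : M), GaloisRep.toLocal v ρ g x = x)
    (hp : ∀ x : M, ∃ n : ℕ, p ^ n • x = 0) (hℓT : ∀ x : M, (ℓ + 1) • x = 0) :
    Nat.card (transverseCondition p ρ ℓ jbar v) = Nat.card M :=
  natCard_eq_of_isCompl_unramifiedSubgroup (GaloisRep.toLocal v ρ) htriv
    (residueFieldCard_sub_one_smul_eq_zero_of_succ_smul hK.1 hℓ hℓP hv hℓT)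
    (isCompl_unramifiedSubgroup_transverseCondition_of_discr_lt p hK hd ρ jbar hℓ hℓP hv htriv hp hℓT)

/-- **`#H¹_tr(K_λ, T) · #H¹_tr(K_λ', T) = #H¹(K_λ, T)`** for places `λ, λ' ∋ ℓ` (at an inert `ℓ`: `λ' = λ = σλ`),
`d_K < −4`, `T` finite `p`-primary with trivial local actions and `(ℓ + 1)·T = 0` — the COUNT input `hcard` of the
isotropy-count criterion for H.4 at `λ ∣ n` (Lemma 1.5.6 «maximal isotropic»).
[cite: Howard2004HeegnerKolyvagin, Prop. 1.1.9 and Lemma 1.5.6 (arXiv:1202.6340 p. 6 L17–25, p. 10 L86–88)] -/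
theorem natCard_transverseCondition_mul_eq_of_discr_lt [Finite M] (p : ℕ) [Fact p.Prime]
    (hK : IsImaginaryQuadratic K) (hd : NumberField.discr K < -4) (ρ : DiscreteGaloisModule K M)
    (jbar : AlgebraicClosure K →+* ℂ) {ℓ : ℕ} (hℓ : ℓ.Prime) (hℓP : (Ideal.span {(ℓ : 𝓞 K)}).IsPrime)
    {v v' : HeightOneSpectrum (𝓞 K)} (hv : (ℓ : 𝓞 K) ∈ v.asIdeal) (hv' : (ℓ : 𝓞 K) ∈ v'.asIdeal)
    (htriv : ∀ (g : absoluteGaloisGroup (v.adicCompletion K)) (x : M), GaloisRep.toLocal v ρ g x = x)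
    (htriv' : ∀ (g : absoluteGaloisGroup (v'.adicCompletion K)) (x : M), GaloisRep.toLocal v' ρ g x = x)
    (hp : ∀ x : M, ∃ n : ℕ, p ^ n • x = 0) (hℓT : ∀ x : M, (ℓ + 1) • x = 0) :
    Nat.card (transverseCondition p ρ ℓ jbar v) * Nat.card (transverseCondition p ρ ℓ jbar v') =
      Nat.card (galoisCohomology (GaloisRep.toLocal v ρ) 1) := by
  rw [natCard_transverseCondition_eq_of_discr_lt p hK hd ρ jbar hℓ hℓP hv htriv hp hℓT,
    natCard_transverseCondition_eq_of_discr_lt p hK hd ρ jbar hℓ hℓP hv' htriv' hp hℓT,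
    natCard_galoisCohomology_toLocal_one_eq_sq_of_succ_smul hK.1 ρ hℓ hℓP hv htriv hℓT, sq]

/-- The same count with the local module written `ρ.toLocal (Sum.inr v)` (the `SelmerStructure` currency of the
isotropy-count criterion `isSelfOrthogonalAt_of_transverse`, whose `hcard` this is after rewriting the two
components `𝓣 (Sum.inr v) = H¹_tr(K_v, T)`, `𝓣 (Sum.inr (σ • v)) = H¹_tr(K_{σv}, T)`).
[cite: Howard2004HeegnerKolyvagin, Prop. 1.1.9 and Lemma 1.5.6 (arXiv:1202.6340 p. 6 L17–25, p. 10 L86–88)] -/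
theorem natCard_transverseCondition_mul_eq_of_discr_lt' [Finite M] (p : ℕ) [Fact p.Prime]
    (hK : IsImaginaryQuadratic K) (hd : NumberField.discr K < -4) (ρ : DiscreteGaloisModule K M)
    (jbar : AlgebraicClosure K →+* ℂ) {ℓ : ℕ} (hℓ : ℓ.Prime) (hℓP : (Ideal.span {(ℓ : 𝓞 K)}).IsPrime)
    {v v' : HeightOneSpectrum (𝓞 K)} (hv : (ℓ : 𝓞 K) ∈ v.asIdeal) (hv' : (ℓ : 𝓞 K) ∈ v'.asIdeal)
    (htriv : ∀ (g : absoluteGaloisGroup (v.adicCompletion K)) (x : M), GaloisRep.toLocal v ρ g x = x)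
    (htriv' : ∀ (g : absoluteGaloisGroup (v'.adicCompletion K)) (x : M), GaloisRep.toLocal v' ρ g x = x)
    (hp : ∀ x : M, ∃ n : ℕ, p ^ n • x = 0) (hℓT : ∀ x : M, (ℓ + 1) • x = 0) :
    Nat.card (transverseCondition p ρ ℓ jbar v) * Nat.card (transverseCondition p ρ ℓ jbar v') =
      Nat.card (galoisCohomology (ρ.toLocal (Sum.inr v)) 1) :=
  natCard_transverseCondition_mul_eq_of_discr_lt p hK hd ρ jbar hℓ hℓP hv hv' htriv htriv' hp hℓT

/-- **`hcyc` discharged at an inert prime** (`d_K < −4`): there is `σ₀ ∈ I_{K_λ}` (any tame generator) with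
`Γ_{K_λ} = ⋃_j σ₀^j · (Γ_{K_λ} ∩ Γ_{K[ℓ]})` — the hypothesis `hcyc` of the transverse complement / isotropy lemmas,
from `exists_pow_inv_mul_mem_localRingClassSubgroup_of_isTameGenerator` with `hGexp` supplied by
`pow_residueFieldCard_sub_one_eq_one_of_mem_ringClassGalOver` («`K[ℓ]_λ/K_λ` is totally tamely ramified, cyclic of
degree `#G_ℓ = ℓ + 1 ∣ q_λ − 1`»).
[cite: Howard2004HeegnerKolyvagin, §1.2 (arXiv:1202.6340 p. 6 L84–95)] [cite: GrossLMS1991, §3 (PDF p. 217 l. 1–3)] -/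
theorem exists_forall_pow_inv_mul_mem_localRingClassSubgroup_of_discr_lt (hK : IsImaginaryQuadratic K)
    (hd : NumberField.discr K < -4) (jbar : AlgebraicClosure K →+* ℂ) {ℓ : ℕ} (hℓ : ℓ.Prime)
    (hℓP : (Ideal.span {(ℓ : 𝓞 K)}).IsPrime) {v : HeightOneSpectrum (𝓞 K)} (hv : (ℓ : 𝓞 K) ∈ v.asIdeal) :
    ∃ σ₀ : absoluteGaloisGroup (v.adicCompletion K), σ₀ ∈ absInertia (v.adicCompletion K) ∧
      ∀ σ : absoluteGaloisGroup (v.adicCompletion K), ∃ j : ℕ, (σ₀ ^ j)⁻¹ * σ ∈ localRingClassSubgroup ℓ jbar v := by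
  obtain ⟨σ₀, hσ₀⟩ := exists_isTameGenerator (F := v.adicCompletion K)
  exact ⟨σ₀, σ₀.2, exists_pow_inv_mul_mem_localRingClassSubgroup_of_isTameGenerator hK jbar hℓ hℓP hv hσ₀
    fun _ hg => pow_residueFieldCard_sub_one_eq_one_of_mem_ringClassGalOver hK hd _ hℓ hℓP hv hg⟩

end Literature.NumberTheory.GaloisCohomology.Howard2004

end
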